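import Mathlib.NumberTheory.NumberField.Basic
import Literature.AlgebraicGeometry.Motives.FaltingsAbelianOfFinitenessIProofs
import Literature.AlgebraicGeometry.Motives.FaltingsAbelianProofs
import Literature.NumberTheory.DiophantineGeometry.AVIsogenyTateHoldsProofs
import HarnessLib

/-!
# Route IsogenyGlueCongruence — item `FaltingsTate` (stmt-ABC-15664): the exact residual over `ℚ`

The item `FaltingsTate` of route `IsogenyGlueCongruence` (stmt-ABC-15664, rank 9, known in print,
formal debt) is Faltings' isogeny theorem in `Hom` form over `ℚ` (the Tate conjecture for
homomorphisms of abelian varieties; G. Faltings, *Endlichkeitssätze für abelsche Varietäten über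
Zahlkörpern*, Invent. Math. 73 (1983), §5, Satz 4 and Korollar 1; English translation in
Cornell–Silverman, *Arithmetic Geometry* (1986), Ch. II, §5, Thm. 4 and Cor. 1), registered with the
signature

`∀ (A B : AbelianVariety.{0} ℚ) (ℓ : ℕ) [Fact ℓ.Prime] [NumberField ℚ],
   Function.Bijective (AbelianVariety.faltingsTateMap A B ℓ)`,

i.e. the body of the Literature named fact `Literature.AlgebraicGeometry.Motives.faltings_tate_bijective`
at `K = ℚ`, for all pairs (`faltingsTate_iff_forall_faltings_tate_bijective`, `Iff.rfl`). The route
file does not (rev 19) declare the decl `FaltingsTate`, so the theorems below are stated against the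
registered signature spelled out verbatim; they apply by `exact` to the decl once it is generated.

This file records, kernel-checked, what the item reduces to in the tree:

* `faltingsTateMap_injective_rat` — the injectivity half is UNCONDITIONAL over `ℚ` (Mumford §19
  Thm. 3, tree theorem `AbelianVariety.faltingsTateMap_injective_holds` from the Theorem of the Cube);
  hence `faltingsTate_iff_forall_surjective`: the item is equivalent to the surjectivity of the Tate
  map for all pairs — the content of Faltings' theorem;
* `faltingsTate_iff_forall_end` — the item is equivalent to its `End` form (Satz 4 for every `P/ℚ`),
  by the tree's corner argument on `End(A ⊞ B)` (`forall_faltings_tate_bijective_iff_forall_end`);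
* `faltingsTate_pair_of_finite_isoClasses_isogenous` — for a pair `(A, B)` the statement follows from
  Finiteness I for the single abelian variety `(A ⊞ B) ⊞ (A ⊞ B)` (tree theorem
  `faltings_tate_bijective_of_finite_isoClasses_isogenous`: Tate's lattice argument, quotients by
  finite stable subgroups, Mumford §19 Thm. 3, Poincaré reducibility with Galois descent — all proved);
* `faltingsTate_of_forall_finite_isoClasses_isogenous` — the whole item from Finiteness I over `ℚ`
  (`∀ P : AbelianVariety ℚ, AbelianVariety.finite_isoClasses_isogenous P`; Faltings 1983 §6 Satz 6
  with Zarhin's trick; Milne, *Abelian Varieties* (2008), IV Thm. 1.1), the ONE outstanding input: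
  the item is blocked on exactly that named fact and on nothing else;
  `faltingsTate_of_faltingsFinitenessI` — the same with the hypothesis in the verbatim signature of
  the gate item `FaltingsFinitenessI` of route `Langlands/PhantomRMYoshida` (stmt-Langlands-15084).

No statement is weakened and nothing is assumed beyond the displayed hypotheses; axioms are the
standard three.

## References

* [Faltings1983Endlichkeit] G. Faltings, Invent. Math. 73 (1983), 349–366, §5 Satz 4, Korollar 1;
  §6 Satz 6.
* [Faltings1986FinitenessTranslation] Cornell–Silverman (eds.), *Arithmetic Geometry* (1986),
  Ch. II, §5 Theorem 4, Corollary 1 (pp. 17–18); §6 Theorem 6.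
* [MilneAV2008] J. S. Milne, *Abelian Varieties* (2008), Ch. IV, Thm. 1.1 (Finiteness I), §2.
* [MumfordAV1970] D. Mumford, *Abelian Varieties* (1970), §19 Thm. 3.
-/

noncomputable section

-- `Summit.<Summit>.<Problem>` is the mandated summit-side namespace (CONVENTIONS §2); for the
-- single-conjunct summit `ABC` the two coincide, so the duplicate `ABC.ABC` is deliberate.
set_option linter.dupNamespace false

namespace Summit.ABC.ABC.Theorems

open CategoryTheory CategoryTheory.Limits
open Literature.AlgebraicGeometry.Motives
open Literature.AlgebraicGeometry.Motives.AbelianVariety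

/-- The registered signature of item `FaltingsTate` (stmt-ABC-15664) is, word for word, the
Literature named fact `faltings_tate_bijective A B ℓ` (Faltings 1983, §5, Satz 4 / Korollar 1) at
`K = ℚ` for all pairs `(A, B)` and all primes `ℓ` (`Iff.rfl`: the fact's body is
`∀ [NumberField K], Function.Bijective (faltingsTateMap A B ℓ)`). -/
theorem faltingsTate_iff_forall_faltings_tate_bijective :
    (∀ (A B : AbelianVariety.{0} ℚ) (ℓ : ℕ) [Fact ℓ.Prime] [NumberField ℚ],
        Function.Bijective (faltingsTateMap A B ℓ)) ↔
      ∀ (A B : AbelianVariety.{0} ℚ) (ℓ : ℕ) [Fact ℓ.Prime], faltings_tate_bijective A B ℓ :=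
  Iff.rfl

/-- **The injectivity half of `FaltingsTate` is unconditional.** For abelian varieties `A`, `B`
over `ℚ` and every prime `ℓ` the Tate map `ℤ_ℓ ⊗ Hom_ℚ(A, B) → Hom_{Γ_ℚ}(T_ℓ A, T_ℓ B)` is
injective (Mumford, *Abelian Varieties*, §19, Thm. 3, over any field of characteristic `≠ ℓ`): the
tree theorem `AbelianVariety.faltingsTateMap_injective_holds` (from the Theorem of the Cube) at
`K = ℚ`, where `(ℓ : ℚ) ≠ 0` (`natCast_ne_zero_of_numberField`). -/
theorem faltingsTateMap_injective_rat (A B : AbelianVariety.{0} ℚ) (ℓ : ℕ) [Fact ℓ.Prime] :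
    Function.Injective (faltingsTateMap A B ℓ) :=
  faltingsTateMap_injective_holds A B ℓ (natCast_ne_zero_of_numberField ℓ)

/-- **`FaltingsTate` is equivalent to surjectivity alone.** Since injectivity is proved
(`faltingsTateMap_injective_rat`), the item holds iff for all abelian varieties `A`, `B` over `ℚ`
and all primes `ℓ` every `Γ_ℚ`-equivariant `ℤ_ℓ`-linear map `T_ℓ A → T_ℓ B` comes from
`ℤ_ℓ ⊗ Hom_ℚ(A, B)` — the content of Faltings 1983, §5, Korollar 1. -/
theorem faltingsTate_iff_forall_surjective :
    (∀ (A B : AbelianVariety.{0} ℚ) (ℓ : ℕ) [Fact ℓ.Prime] [NumberField ℚ],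
        Function.Bijective (faltingsTateMap A B ℓ)) ↔
      ∀ (A B : AbelianVariety.{0} ℚ) (ℓ : ℕ) [Fact ℓ.Prime],
        Function.Surjective (faltingsTateMap A B ℓ) :=
  ⟨fun h A B ℓ _ ↦ (h A B ℓ).2, fun h A B ℓ _ _ ↦ ⟨faltingsTateMap_injective_rat A B ℓ, h A B ℓ⟩⟩

/-- **`FaltingsTate` is equivalent to its `End` form** (Faltings 1983, §5: Korollar 1 is "Satz 4
applied to `A₁ × A₂`"): bijectivity of the Tate map for all pairs `(A, B)` over `ℚ` iff bijectivity
of `ℤ_p ⊗ End_ℚ(B) → End_{Γ_ℚ}(T_p B)` for every single `B/ℚ` and every prime `p`, by the tree's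
corner argument on `End(A ⊞ B)` (`forall_faltings_tate_bijective_iff_forall_end`). The right-hand
side is, word for word, the first conjunct of the gate `FaltingsTateModuleQ` of route
`Langlands/PhantomRMYoshida` (item stmt-Langlands-15085). -/
theorem faltingsTate_iff_forall_end :
    (∀ (A B : AbelianVariety.{0} ℚ) (ℓ : ℕ) [Fact ℓ.Prime] [NumberField ℚ],
        Function.Bijective (faltingsTateMap A B ℓ)) ↔
      ∀ (p : ℕ) [Fact p.Prime] (B : AbelianVariety.{0} ℚ),
        Function.Bijective (faltingsTateMap B B p) :=
  ⟨fun h p _ B ↦ h B B p, fun h A B ℓ _ ↦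
    (forall_faltings_tate_bijective_iff_forall_end (K := ℚ) ℓ).2 (fun P _ ↦ h ℓ P) A B⟩

/-- **`FaltingsTate` for one pair from Finiteness I for one abelian variety.** For abelian
varieties `A`, `B` over `ℚ` and a prime `ℓ`, the Tate map `ℤ_ℓ ⊗ Hom_ℚ(A, B) → Hom_{Γ_ℚ}(T_ℓ A, T_ℓ B)`
is bijective, granted Finiteness I (Milne, *Abelian Varieties* (2008), IV Thm. 1.1; Faltings 1983,
§6 Satz 6 with Zarhin's trick) for the abelian variety `(A ⊞ B) ⊞ (A ⊞ B)` — the tree theorem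
`faltings_tate_bijective_of_finite_isoClasses_isogenous` (Faltings 1983, §5, Korollar 1 from
Finiteness I alone: every other input of the printed proof is proved in the tree) at `K = ℚ`. -/
theorem faltingsTate_pair_of_finite_isoClasses_isogenous (A B : AbelianVariety.{0} ℚ) (ℓ : ℕ)
    [Fact ℓ.Prime] (hfin : finite_isoClasses_isogenous ((A ⊞ B) ⊞ (A ⊞ B))) [NumberField ℚ] :
    Function.Bijective (faltingsTateMap A B ℓ) :=
  faltings_tate_bijective_of_finite_isoClasses_isogenous A B ℓ hfin

/-- **`FaltingsTate` from Finiteness I over `ℚ` — the item's single outstanding input.** If every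
abelian variety `P/ℚ` has, up to isomorphism, only finitely many abelian varieties over `ℚ`
isogenous to it (`AbelianVariety.finite_isoClasses_isogenous P`, Finiteness I: Faltings 1983, §6
Satz 6 with Zarhin's trick; Milne (2008), IV Thm. 1.1 — an unproved named fact of the tree), then
the registered signature of item `FaltingsTate` (stmt-ABC-15664) holds: Faltings 1983, §5,
Korollar 1 for all pairs over `ℚ` (`faltings_tate_bijective_of_forall_finite_isoClasses_isogenous`). -/
theorem faltingsTate_of_forall_finite_isoClasses_isogenous
    (hfin : ∀ P : AbelianVariety.{0} ℚ, finite_isoClasses_isogenous P) :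
    ∀ (A B : AbelianVariety.{0} ℚ) (ℓ : ℕ) [Fact ℓ.Prime] [NumberField ℚ],
      Function.Bijective (faltingsTateMap A B ℓ) :=
  fun A B ℓ _ ↦ faltings_tate_bijective_of_forall_finite_isoClasses_isogenous ℓ hfin A B

/-- **`FaltingsTate` from Finiteness I over `ℚ` in item form.** The same implication with the
hypothesis spelled word for word as the registered signature of the gate `FaltingsFinitenessI` of
route `Langlands/PhantomRMYoshida` (item stmt-Langlands-15084: for every `A/ℚ` there are finitely
many `C i /ℚ` such that every `B/ℚ` with an isogeny `B → A` is isomorphic to some `C i`; Faltings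
1983, §6 Satz 6 with Zarhin's trick; Milne (2008), IV Thm. 1.1), whose instance binder
`[NumberField ℚ]` of the Literature fact is supplied by `Rat.numberField`: whatever closes that
item closes this one by this theorem. -/
theorem faltingsTate_of_faltingsFinitenessI
    (hFin : ∀ A : AbelianVariety.{0} ℚ, ∃ (n : ℕ) (C : Fin n → AbelianVariety.{0} ℚ),
      ∀ B : AbelianVariety.{0} ℚ, IsIsogenous B A → ∃ i, Nonempty (B ≅ C i)) :
    ∀ (A B : AbelianVariety.{0} ℚ) (ℓ : ℕ) [Fact ℓ.Prime] [NumberField ℚ],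
      Function.Bijective (faltingsTateMap A B ℓ) :=
  faltingsTate_of_forall_finite_isoClasses_isogenous fun P _ ↦ hFin P

end Summit.ABC.ABC.Theorems
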